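import Mathlib.MeasureTheory.Integral.IntervalIntegral.Basic
import Mathlib.MeasureTheory.Function.Floor
import Mathlib.Analysis.InnerProductSpace.PiL2

/-!
# Crux `LayeredLawsSelectHcp` (stmt-AtomisticToContinuum-9226), line `mtp-prestress-split-ergodic-frame`:
# the threshold (Kuhn–Freudenthal) interpolant — vertex values and the deviation estimate
# (`stub_thresholdInterpolation`, T1)

Registered sub-goal `stub_thresholdInterpolation` (T1 of the threshold-interpolation assembly of the bulk
co-Lipschitz ranges, lead c4).  For labelled data `Y : ℤ³ → ℝ³` put
`G x = ∫₀¹ Y ⌈x − t·(1,1,1)⌉ dt` (`x ∈ ℝ³`, ceilings componentwise).  Then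

* (i) `G m = Y m` at integer points: for `t ∈ (0,1)`, `⌈m_j − t⌉ = m_j`
  (`threshold_ceil_intCast_sub`), so the integrand is constant on the open unit interval;
* (ii) for every linear `M : ℝ³ → ℝ³`, all `x, y` and every `D ≥ 0` bounding
  `‖(Y − M)⌈x − t⌉ − (Y − M)⌈y − t⌉‖` for all `t ∈ (0,1)`:
  `‖G x − G y − M (x − y)‖ ≤ D (|x₁ − y₁| + |x₂ − y₂| + |x₃ − y₃|)`.

Proof of (ii).  The one-dimensional identity `∫₀¹ ⌈s − t⌉ dt = s` (`threshold_integral_ceil_sub`: the ceiling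
is `⌈s⌉` on `(0, s − ⌈s⌉ + 1)` and `⌈s⌉ − 1` on `(s − ⌈s⌉ + 1, 1)`) and linearity give
`M x = ∫₀¹ M ⌈x − t⌉ dt` (`threshold_integral_linear`), so the difference is the integral of
`Φ t = (Y − M)⌈x − t⌉ − (Y − M)⌈y − t⌉`.  Pointwise, `‖Φ t‖ ≤ D · Σ_j |⌈x_j − t⌉ − ⌈y_j − t⌉|`: the sum of
integer differences is `≥ 1` unless the two labels coincide, in which case `Φ t = 0`
(`threshold_norm_sub_le`).  Finally `∫₀¹ |⌈s − t⌉ − ⌈s' − t⌉| dt = |s − s'|` (`threshold_integral_abs_ceil_sub`: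
the ceiling is monotone, so the integrand has a constant sign and the identity above applies twice) — this
replaces the measure count of the set where the labels differ.  Integrability: `t ↦ ⌈s − t⌉` is antitone,
and `t ↦ Y ⌈x − t⌉` is strongly measurable (countable label set) and takes values in the finite cube
`∏ {⌈x_j⌉ − 1, ⌈x_j⌉}` on `[0, 1]`.  Pure real analysis (interval integrals), Mathlib only.  All `[folklore]`.
-/

noncomputable section

namespace Summit.AtomisticToContinuum.Crystallization.Theorems.PalmUnimodularRigidity.LayeredLawsSelectHcp

open MeasureTheory Set intervalIntegral

/-- For an integer `k` and `t ∈ (0, 1)`, `⌈k − t⌉ = k`. [folklore] -/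
theorem threshold_ceil_intCast_sub (k : ℤ) {t : ℝ} (ht : t ∈ Ioo (0 : ℝ) 1) :
    ⌈(k : ℝ) - t⌉ = k := by
  rw [Int.ceil_eq_iff]
  constructor <;> linarith [ht.1, ht.2]

/-- `t ↦ ⌈s − t⌉` (cast to `ℝ`) is antitone. [folklore] -/
theorem threshold_antitone_ceil_sub (s : ℝ) : Antitone fun t : ℝ => ((⌈s - t⌉ : ℤ) : ℝ) := by
  intro t₁ t₂ h
  exact Int.cast_le.mpr (Int.ceil_le_ceil (by linarith))

/-- `t ↦ ⌈s − t⌉` (cast to `ℝ`) is interval integrable on every interval. [folklore] -/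
theorem threshold_intervalIntegrable_ceil_sub (s a b : ℝ) :
    IntervalIntegrable (fun t : ℝ => ((⌈s - t⌉ : ℤ) : ℝ)) volume a b :=
  (threshold_antitone_ceil_sub s).intervalIntegrable

/-- **`∫₀¹ ⌈s − t⌉ dt = s`.**  The ceiling equals `⌈s⌉` for `t ∈ (0, s − ⌈s⌉ + 1)` and `⌈s⌉ − 1` for
`t ∈ (s − ⌈s⌉ + 1, 1)`; the two constant pieces add up to `s`. [folklore] -/
theorem threshold_integral_ceil_sub (s : ℝ) :
    ∫ t in (0 : ℝ)..1, ((⌈s - t⌉ : ℤ) : ℝ) = s := by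
  obtain ⟨n, hn⟩ : ∃ n : ℤ, ⌈s⌉ = n := ⟨_, rfl⟩
  have hs1 : (n : ℝ) - 1 < s := by
    have := Int.ceil_lt_add_one s
    rw [hn] at this
    linarith
  have hs2 : s ≤ n := by
    have := Int.le_ceil s
    rwa [hn] at this
  have h1 : ∫ t in (0 : ℝ)..(s - n + 1), ((⌈s - t⌉ : ℤ) : ℝ) = ∫ _ in (0 : ℝ)..(s - n + 1), (n : ℝ) := by
    refine integral_congr_Ioo_of_le (by linarith) (fun t ht => ?_)
    have : ⌈s - t⌉ = n := by
      rw [Int.ceil_eq_iff]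
      constructor <;> linarith [ht.1, ht.2]
    simp [this]
  have h2 : ∫ t in (s - n + 1)..(1 : ℝ), ((⌈s - t⌉ : ℤ) : ℝ) =
      ∫ _ in (s - n + 1)..(1 : ℝ), ((n : ℝ) - 1) := by
    refine integral_congr_Ioo_of_le (by linarith) (fun t ht => ?_)
    have : ⌈s - t⌉ = n - 1 := by
      rw [Int.ceil_eq_iff]
      push_cast
      constructor <;> linarith [ht.1, ht.2]
    simp [this]
  rw [← integral_add_adjacent_intervals (threshold_intervalIntegrable_ceil_sub s 0 (s - n + 1))
    (threshold_intervalIntegrable_ceil_sub s (s - n + 1) 1), h1, h2,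
    intervalIntegral.integral_const, intervalIntegral.integral_const]
  simp only [smul_eq_mul]
  ring

/-- **`∫₀¹ |⌈s − t⌉ − ⌈s' − t⌉| dt = |s − s'|`.**  By monotonicity of the ceiling the integrand has a
constant sign, so this is `threshold_integral_ceil_sub` twice. [folklore] -/
theorem threshold_integral_abs_ceil_sub (s s' : ℝ) :
    ∫ t in (0 : ℝ)..1, |((⌈s - t⌉ : ℤ) : ℝ) - ((⌈s' - t⌉ : ℤ) : ℝ)| = |s - s'| := by
  wlog h : s' ≤ s generalizing s s' with H
  · rw [abs_sub_comm, ← H s' s (not_le.mp h).le]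
    exact integral_congr fun t _ => abs_sub_comm _ _
  have hpt : ∀ t : ℝ, |((⌈s - t⌉ : ℤ) : ℝ) - ((⌈s' - t⌉ : ℤ) : ℝ)| =
      ((⌈s - t⌉ : ℤ) : ℝ) - ((⌈s' - t⌉ : ℤ) : ℝ) := fun t =>
    abs_of_nonneg (sub_nonneg.mpr (Int.cast_le.mpr (Int.ceil_le_ceil (by linarith))))
  simp_rw [hpt]
  rw [integral_sub (threshold_intervalIntegrable_ceil_sub s 0 1)
    (threshold_intervalIntegrable_ceil_sub s' 0 1), threshold_integral_ceil_sub,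
    threshold_integral_ceil_sub, abs_of_nonneg (sub_nonneg.mpr h)]

/-- A linear map on `ℝ × ℝ × ℝ` in coordinates:
`M p = p₁ • M e₁ + p₂ • M e₂ + p₃ • M e₃`. [folklore] -/
theorem threshold_linearMap_apply (M : ℝ × ℝ × ℝ →ₗ[ℝ] EuclideanSpace ℝ (Fin 3)) (p : ℝ × ℝ × ℝ) :
    M p = p.1 • M (1, 0, 0) + p.2.1 • M (0, 1, 0) + p.2.2 • M (0, 0, 1) := by
  have hp : p = p.1 • ((1 : ℝ), (0 : ℝ), (0 : ℝ)) + p.2.1 • ((0 : ℝ), (1 : ℝ), (0 : ℝ)) +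
      p.2.2 • ((0 : ℝ), (0 : ℝ), (1 : ℝ)) := by
    ext <;> simp
  conv_lhs => rw [hp]
  simp only [map_add, map_smul]

/-- The linear part of the integrand in coordinates, as a function of `t`. [folklore] -/
theorem threshold_linear_comp (M : ℝ × ℝ × ℝ →ₗ[ℝ] EuclideanSpace ℝ (Fin 3)) (x : ℝ × ℝ × ℝ) :
    (fun t : ℝ => M ((⌈x.1 - t⌉ : ℝ), (⌈x.2.1 - t⌉ : ℝ), (⌈x.2.2 - t⌉ : ℝ))) =
      fun t : ℝ => ((⌈x.1 - t⌉ : ℤ) : ℝ) • M (1, 0, 0) + ((⌈x.2.1 - t⌉ : ℤ) : ℝ) • M (0, 1, 0) +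
        ((⌈x.2.2 - t⌉ : ℤ) : ℝ) • M (0, 0, 1) := by
  funext t
  exact threshold_linearMap_apply M _

/-- `t ↦ ⌈s − t⌉ • v` is interval integrable on `[0, 1]`. [folklore] -/
theorem threshold_intervalIntegrable_ceil_sub_smul (s : ℝ) (v : EuclideanSpace ℝ (Fin 3)) :
    IntervalIntegrable (fun t : ℝ => ((⌈s - t⌉ : ℤ) : ℝ) • v) volume 0 1 :=
  (threshold_intervalIntegrable_ceil_sub s 0 1).smul_continuousOn continuousOn_const

/-- The linear part `t ↦ M ⌈x − t⌉` of the integrand is interval integrable on `[0, 1]`. [folklore] -/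
theorem threshold_intervalIntegrable_linear (M : ℝ × ℝ × ℝ →ₗ[ℝ] EuclideanSpace ℝ (Fin 3))
    (x : ℝ × ℝ × ℝ) :
    IntervalIntegrable (fun t : ℝ => M ((⌈x.1 - t⌉ : ℝ), (⌈x.2.1 - t⌉ : ℝ), (⌈x.2.2 - t⌉ : ℝ)))
      volume 0 1 := by
  rw [threshold_linear_comp]
  exact ((threshold_intervalIntegrable_ceil_sub_smul _ _).add
    (threshold_intervalIntegrable_ceil_sub_smul _ _)).add
    (threshold_intervalIntegrable_ceil_sub_smul _ _)

/-- **`∫₀¹ M ⌈x − t⌉ dt = M x`** for linear `M` (coordinatewise `threshold_integral_ceil_sub`). [folklore] -/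
theorem threshold_integral_linear (M : ℝ × ℝ × ℝ →ₗ[ℝ] EuclideanSpace ℝ (Fin 3)) (x : ℝ × ℝ × ℝ) :
    ∫ t in (0 : ℝ)..1, M ((⌈x.1 - t⌉ : ℝ), (⌈x.2.1 - t⌉ : ℝ), (⌈x.2.2 - t⌉ : ℝ)) = M x := by
  rw [threshold_linear_comp, integral_add ((threshold_intervalIntegrable_ceil_sub_smul _ _).add
      (threshold_intervalIntegrable_ceil_sub_smul _ _)) (threshold_intervalIntegrable_ceil_sub_smul _ _),
    integral_add (threshold_intervalIntegrable_ceil_sub_smul _ _)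
      (threshold_intervalIntegrable_ceil_sub_smul _ _),
    intervalIntegral.integral_smul_const, intervalIntegral.integral_smul_const,
    intervalIntegral.integral_smul_const, threshold_integral_ceil_sub,
    threshold_integral_ceil_sub, threshold_integral_ceil_sub]
  exact (threshold_linearMap_apply M x).symm

/-- The label path `t ↦ ⌈x − t·(1,1,1)⌉ ∈ ℤ³` is measurable (`Int.measurable_ceil`). [folklore] -/
theorem threshold_measurable_labels (x : ℝ × ℝ × ℝ) :
    Measurable fun t : ℝ => ((⌈x.1 - t⌉, ⌈x.2.1 - t⌉, ⌈x.2.2 - t⌉) : ℤ × ℤ × ℤ) := by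
  have h : ∀ s : ℝ, Measurable fun t : ℝ => ⌈s - t⌉ := fun s =>
    Int.measurable_ceil.comp (measurable_const.sub measurable_id)
  exact (h x.1).prodMk ((h x.2.1).prodMk (h x.2.2))

/-- For `t ∈ [0, 1]` the label `⌈s − t⌉` lies in `{⌈s⌉ − 1, ⌈s⌉}`. [folklore] -/
theorem threshold_ceil_sub_mem_Icc (s : ℝ) {t : ℝ} (h0 : 0 ≤ t) (h1 : t ≤ 1) :
    ⌈s - t⌉ ∈ Finset.Icc (⌈s⌉ - 1) ⌈s⌉ := by
  rw [Finset.mem_Icc, ← Int.ceil_sub_one]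
  exact ⟨Int.ceil_le_ceil (by linarith), Int.ceil_le_ceil (by linarith)⟩

/-- **The integrand `t ↦ Y ⌈x − t⌉` is interval integrable on `[0, 1]`**: it is strongly measurable
(countable label set, measurable label path) and bounded by `Σ ‖Y m‖` over the finite cube of labels
`∏ {⌈x_j⌉ − 1, ⌈x_j⌉}` it visits. [folklore] -/
theorem threshold_intervalIntegrable_labels (Y : ℤ × ℤ × ℤ → EuclideanSpace ℝ (Fin 3))
    (x : ℝ × ℝ × ℝ) :
    IntervalIntegrable (fun t : ℝ => Y (⌈x.1 - t⌉, ⌈x.2.1 - t⌉, ⌈x.2.2 - t⌉)) volume 0 1 := by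
  obtain ⟨S, hS⟩ : ∃ S : Finset (ℤ × ℤ × ℤ), S = Finset.Icc (⌈x.1⌉ - 1) ⌈x.1⌉ ×ˢ
      (Finset.Icc (⌈x.2.1⌉ - 1) ⌈x.2.1⌉ ×ˢ Finset.Icc (⌈x.2.2⌉ - 1) ⌈x.2.2⌉) := ⟨_, rfl⟩
  refine (intervalIntegrable_const (c := ∑ m ∈ S, ‖Y m‖)).mono_fun' ?_ ?_
  · exact ((StronglyMeasurable.of_discrete (f := Y)).comp_measurable
      (threshold_measurable_labels x)).aestronglyMeasurable
  · rw [uIoc_of_le zero_le_one]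
    refine ae_restrict_of_forall_mem measurableSet_Ioc fun t ht => ?_
    have hmem : (⌈x.1 - t⌉, ⌈x.2.1 - t⌉, ⌈x.2.2 - t⌉) ∈ S := by
      rw [hS, Finset.mem_product, Finset.mem_product]
      exact ⟨threshold_ceil_sub_mem_Icc _ ht.1.le ht.2, threshold_ceil_sub_mem_Icc _ ht.1.le ht.2,
        threshold_ceil_sub_mem_Icc _ ht.1.le ht.2⟩
    exact Finset.single_le_sum (f := fun m => ‖Y m‖) (fun m _ => norm_nonneg (Y m)) hmem

/-- Three integers that are not all equal to three others differ by at least `1` in `ℓ¹`. [folklore] -/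
theorem threshold_one_le_abs_sub {a b c a' b' c' : ℤ} (h : (a, b, c) ≠ (a', b', c')) :
    (1 : ℝ) ≤ |(a : ℝ) - a'| + |(b : ℝ) - b'| + |(c : ℝ) - c'| := by
  have key : ∀ {u v : ℤ}, u ≠ v → (1 : ℝ) ≤ |(u : ℝ) - v| := by
    intro u v huv
    have : (1 : ℤ) ≤ |u - v| := Int.one_le_abs (sub_ne_zero.mpr huv)
    exact_mod_cast this
  have ha := abs_nonneg ((a : ℝ) - a')
  have hb := abs_nonneg ((b : ℝ) - b')
  have hc := abs_nonneg ((c : ℝ) - c')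
  by_cases h1 : a = a'
  · by_cases h2 : b = b'
    · by_cases h3 : c = c'
      · exact absurd (by rw [h1, h2, h3]) h
      · linarith [key h3]
    · linarith [key h2]
  · linarith [key h1]

/-- **Pointwise bound.**  If the two `(Y − M)`-values are `D`-close (`D ≥ 0`), then their difference is
bounded by `D · Σ_j |⌈x_j − t⌉ − ⌈y_j − t⌉|`: the sum is `≥ 1` unless the labels coincide, and then the
difference vanishes. [folklore] -/
theorem threshold_norm_sub_le (Y : ℤ × ℤ × ℤ → EuclideanSpace ℝ (Fin 3))
    (M : ℝ × ℝ × ℝ →ₗ[ℝ] EuclideanSpace ℝ (Fin 3)) {D : ℝ} (hD : 0 ≤ D) (a b c a' b' c' : ℤ)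
    (hclose : ‖(Y (a, b, c) - M ((a : ℝ), (b : ℝ), (c : ℝ))) -
      (Y (a', b', c') - M ((a' : ℝ), (b' : ℝ), (c' : ℝ)))‖ ≤ D) :
    ‖(Y (a, b, c) - M ((a : ℝ), (b : ℝ), (c : ℝ))) - (Y (a', b', c') - M ((a' : ℝ), (b' : ℝ), (c' : ℝ)))‖ ≤
      D * (|(a : ℝ) - a'| + |(b : ℝ) - b'| + |(c : ℝ) - c'|) := by
  by_cases h : (a, b, c) = (a', b', c')
  · simp only [Prod.mk.injEq] at h
    obtain ⟨rfl, rfl, rfl⟩ := h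
    simp
  · calc _ ≤ D := hclose
      _ = D * 1 := (mul_one D).symm
      _ ≤ _ := mul_le_mul_of_nonneg_left (threshold_one_le_abs_sub h) hD

/-- **Registered sub-goal `stub_thresholdInterpolation` (T1): the threshold (Kuhn–Freudenthal) interpolant —
vertex values and the deviation estimate.**  For labelled data `Y : ℤ³ → ℝ³` put
`G x = ∫₀¹ Y ⌈x − t·(1,1,1)⌉ dt` (`x ∈ ℝ³`, ceilings componentwise).  Then (i) `G m = Y m` at integer points
(for `t ∈ (0,1)`, `⌈m_j − t⌉ = m_j`), and (ii) for every linear `M : ℝ³ → ℝ³`, all `x, y` and every `D ≥ 0`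
bounding `‖(Y − M)⌈x − t⌉ − (Y − M)⌈y − t⌉‖` for all `t ∈ (0,1)`:
`‖G x − G y − M (x − y)‖ ≤ D (|x₁ − y₁| + |x₂ − y₂| + |x₃ − y₃|)`.  Proof: `∫₀¹ ⌈x_j − t⌉ dt = x_j`
(`threshold_integral_ceil_sub`), so by linearity `M (x − y) = ∫₀¹ (M⌈x−t⌉ − M⌈y−t⌉) dt`
(`threshold_integral_linear`) and the difference is `∫₀¹ [(Y−M)⌈x−t⌉ − (Y−M)⌈y−t⌉] dt`; the integrand is
bounded by `D Σ_j |⌈x_j − t⌉ − ⌈y_j − t⌉|` (`threshold_norm_sub_le`) and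
`∫₀¹ |⌈x_j − t⌉ − ⌈y_j − t⌉| dt = |x_j − y_j|` (`threshold_integral_abs_ceil_sub`).  Integrability:
`threshold_intervalIntegrable_labels`, `threshold_intervalIntegrable_linear`.  Pure real analysis (interval
integrals), no project imports. [folklore] -/
theorem stub_thresholdInterpolation :
    ∀ (Y : ℤ × ℤ × ℤ → EuclideanSpace ℝ (Fin 3)),
      (∀ m : ℤ × ℤ × ℤ,
        (∫ t in (0 : ℝ)..1, Y (⌈(m.1 : ℝ) - t⌉, ⌈(m.2.1 : ℝ) - t⌉, ⌈(m.2.2 : ℝ) - t⌉)) = Y m) ∧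
      ∀ (M : ℝ × ℝ × ℝ →ₗ[ℝ] EuclideanSpace ℝ (Fin 3)) (x y : ℝ × ℝ × ℝ) (D : ℝ), 0 ≤ D →
        (∀ t ∈ Set.Ioo (0 : ℝ) 1,
          ‖(Y (⌈x.1 - t⌉, ⌈x.2.1 - t⌉, ⌈x.2.2 - t⌉) -
              M ((⌈x.1 - t⌉ : ℝ), (⌈x.2.1 - t⌉ : ℝ), (⌈x.2.2 - t⌉ : ℝ))) -
            (Y (⌈y.1 - t⌉, ⌈y.2.1 - t⌉, ⌈y.2.2 - t⌉) -
              M ((⌈y.1 - t⌉ : ℝ), (⌈y.2.1 - t⌉ : ℝ), (⌈y.2.2 - t⌉ : ℝ)))‖ ≤ D) →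
        ‖(∫ t in (0 : ℝ)..1, Y (⌈x.1 - t⌉, ⌈x.2.1 - t⌉, ⌈x.2.2 - t⌉)) -
            (∫ t in (0 : ℝ)..1, Y (⌈y.1 - t⌉, ⌈y.2.1 - t⌉, ⌈y.2.2 - t⌉)) - M (x - y)‖ ≤
          D * (|x.1 - y.1| + |x.2.1 - y.2.1| + |x.2.2 - y.2.2|) := by
  intro Y
  refine ⟨fun m => ?_, fun M x y D hD hclose => ?_⟩
  · -- (i) vertex values: the integrand is the constant `Y m` on `(0, 1)`
    rw [integral_congr_Ioo_of_le zero_le_one (g := fun _ => Y m), intervalIntegral.integral_const,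
      sub_zero, one_smul]
    intro t ht
    simp only [threshold_ceil_intCast_sub _ ht]
  · -- (ii) the deviation estimate
    have hYx := threshold_intervalIntegrable_labels Y x
    have hYy := threshold_intervalIntegrable_labels Y y
    have hMx := threshold_intervalIntegrable_linear M x
    have hMy := threshold_intervalIntegrable_linear M y
    -- rewrite the left-hand side as a single interval integral
    have hrepr : (∫ t in (0 : ℝ)..1, Y (⌈x.1 - t⌉, ⌈x.2.1 - t⌉, ⌈x.2.2 - t⌉)) -
        (∫ t in (0 : ℝ)..1, Y (⌈y.1 - t⌉, ⌈y.2.1 - t⌉, ⌈y.2.2 - t⌉)) - M (x - y) =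
        ∫ t in (0 : ℝ)..1, ((Y (⌈x.1 - t⌉, ⌈x.2.1 - t⌉, ⌈x.2.2 - t⌉) -
            M ((⌈x.1 - t⌉ : ℝ), (⌈x.2.1 - t⌉ : ℝ), (⌈x.2.2 - t⌉ : ℝ))) -
          (Y (⌈y.1 - t⌉, ⌈y.2.1 - t⌉, ⌈y.2.2 - t⌉) -
            M ((⌈y.1 - t⌉ : ℝ), (⌈y.2.1 - t⌉ : ℝ), (⌈y.2.2 - t⌉ : ℝ)))) := by
      rw [integral_sub (hYx.sub hMx) (hYy.sub hMy), integral_sub hYx hMx, integral_sub hYy hMy,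
        threshold_integral_linear, threshold_integral_linear, map_sub]
      abel
    -- the dominating function and its integral
    have hI := threshold_intervalIntegrable_ceil_sub
    have hg : IntervalIntegrable (fun t : ℝ => D * (|((⌈x.1 - t⌉ : ℤ) : ℝ) - ((⌈y.1 - t⌉ : ℤ) : ℝ)| +
        |((⌈x.2.1 - t⌉ : ℤ) : ℝ) - ((⌈y.2.1 - t⌉ : ℤ) : ℝ)| +
        |((⌈x.2.2 - t⌉ : ℤ) : ℝ) - ((⌈y.2.2 - t⌉ : ℤ) : ℝ)|)) volume 0 1 :=
      ((((hI x.1 0 1).sub (hI y.1 0 1)).abs.add ((hI x.2.1 0 1).sub (hI y.2.1 0 1)).abs).add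
        ((hI x.2.2 0 1).sub (hI y.2.2 0 1)).abs).const_mul D
    have hgint : ∫ t in (0 : ℝ)..1, D * (|((⌈x.1 - t⌉ : ℤ) : ℝ) - ((⌈y.1 - t⌉ : ℤ) : ℝ)| +
        |((⌈x.2.1 - t⌉ : ℤ) : ℝ) - ((⌈y.2.1 - t⌉ : ℤ) : ℝ)| +
        |((⌈x.2.2 - t⌉ : ℤ) : ℝ) - ((⌈y.2.2 - t⌉ : ℤ) : ℝ)|) =
        D * (|x.1 - y.1| + |x.2.1 - y.2.1| + |x.2.2 - y.2.2|) := by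
      rw [intervalIntegral.integral_const_mul, integral_add (((hI x.1 0 1).sub (hI y.1 0 1)).abs.add
          ((hI x.2.1 0 1).sub (hI y.2.1 0 1)).abs) ((hI x.2.2 0 1).sub (hI y.2.2 0 1)).abs,
        integral_add ((hI x.1 0 1).sub (hI y.1 0 1)).abs ((hI x.2.1 0 1).sub (hI y.2.1 0 1)).abs,
        threshold_integral_abs_ceil_sub, threshold_integral_abs_ceil_sub,
        threshold_integral_abs_ceil_sub]
    rw [hrepr, ← hgint]
    refine norm_integral_le_of_norm_le zero_le_one ?_ hg
    filter_upwards [(volume : Measure ℝ).ae_ne 1] with t ht1 ht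
    exact threshold_norm_sub_le Y M hD _ _ _ _ _ _ (hclose t ⟨ht.1, lt_of_le_of_ne ht.2 ht1⟩)

end Summit.AtomisticToContinuum.Crystallization.Theorems.PalmUnimodularRigidity.LayeredLawsSelectHcp

end
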